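import Literature.Computability.Complexity.HarnikRazApproximators
import HarnessLib

/-!
# The monotone lower bound for the Harnik–Raz function, parametric form (CKR Thm. 2.19)

The assembly of Cavalar–Kumar–Rossman's proof (Algorithmica 84 (2022), §2.7, proof of
Thm. 2.19) for arbitrary parameters: for a prime `n`, `2 ≤ c`, `k < n`, `0 < ε ≤ 1/2` and the
parameter hypothesis `2 B log(c/ε) · k/n ≤ 1/3` (`B = spreadConst`; CKR take `k = n^{1/2}`,
`ε = n^{-2c}`, `c = k/(18 B log n)`), every circuit over `{∧₂, ∨₂}` computing the Harnik–Raz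
function `harnikRazFn n c k` has

`size · (½ 3^{-⌊c/2⌋} + ε · #{A : |A| ≤ c}) ≥ ½ - (k-1)/n - n^c 2^{-⌈k/2⌉}`

(`harnikRaz_size_mul_ge`), i.e. size `2^{Ω(c)}` once the right-hand side is `≥ 3/10` and
`ε #{A : |A| ≤ c} ≤ 3^{-c/2}`. The asymptotic statement `cavalar_kumar_rossman` of
`RobustSunflowerBound.lean` is derived from it in `RobustSunflowerBoundProofs.lean`.

* `prHalf_harnikRazFn_le` — **CKR Lemma 2.4**: `Pr[f_HR(𝐍) = 1] ≤ n^c 2^{-⌈k/2⌉}`;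
* `sum_val_add_prHalf_not_mem_le` — **CKR Lemma 2.17**: `Pr[𝒜(𝐘) = 1] + Pr[𝒜(𝐍) = 0] ≤ 3/2`;
* `harnikRaz_size_mul_ge` — **CKR Thm. 2.19** (parametric), from
  `ApproxScheme.exists_approx_circuit` with the scheme and error bounds of
  `HarnikRazApproximators.lean` and the test-distribution lemmas of `HarnikRazTest.lean`.

## References

* B. P. Cavalar, M. Kumar, B. Rossman, *Monotone circuit lower bounds from robust sunflowers*,
  Algorithmica 84 (2022), §2.3 (Lemma 2.4), §2.7 (Lemma 2.17, Thm. 2.19)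
  [CavalarKumarRossman2022].
-/

namespace Literature.Computability.Complexity.CKR

open Finset Razborov Literature.Combinatorics.SetFamily

variable {n : ℕ} [Fact n.Prime] {c k : ℕ} {ε : ℝ}

/-- `Pr[S ⊆ 𝐍] = 2^{-|S|}` for the uniform input. [folklore] -/
theorem prHalf_subset (S : Finset (ZMod n)) :
    prHalf (fun U : Finset (ZMod n) => S ⊆ U) = (1 / 2 : ℝ) ^ #S := by
  rw [prHalf_eq_sum_biasedWeight, sum_biasedWeight_filter_subset]

/-- **CKR Lemma 2.4** (`f_HR` rejects the uniform input with high probability):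
`Pr[f_HR(𝐍) = 1] ≤ n^c · 2^{-⌈k/2⌉}`, since `f_HR(x_U) = 1` forces `U ⊇ S_v` for one of the
`n^c` coefficient vectors `v` with `|S_v| ≥ k/2`. [cite: CavalarKumarRossman2022, Lemma 2.4] -/
theorem prHalf_harnikRazFn_le :
    prHalf (fun U : Finset (ZMod n) => harnikRazFn n c k (finsetEquivFun U) = true)
      ≤ (n : ℝ) ^ c * (1 / 2 : ℝ) ^ ((k + 1) / 2) := by
  classical
  set s : Finset (Fin c → ZMod n) := univ.filter fun v => k ≤ 2 * #(hrSet k v) with hs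
  calc prHalf (fun U : Finset (ZMod n) => harnikRazFn n c k (finsetEquivFun U) = true)
      ≤ prHalf (fun U : Finset (ZMod n) => ∃ v ∈ s, hrSet k v ⊆ U) := by
        refine prHalf_mono fun U hU => ?_
        obtain ⟨v, hv, hvU⟩ := exists_hrSet_of_harnikRazFn hU
        exact ⟨v, mem_filter.2 ⟨mem_univ _, hv⟩, hvU⟩
    _ ≤ ∑ v ∈ s, prHalf (fun U : Finset (ZMod n) => hrSet k v ⊆ U) := prHalf_exists_le_sum s _
    _ ≤ ∑ v ∈ s, (1 / 2 : ℝ) ^ ((k + 1) / 2) := by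
        refine sum_le_sum fun v hv => ?_
        rw [prHalf_subset]
        have hk : (k + 1) / 2 ≤ #(hrSet k v) := by have := (mem_filter.1 hv).2; omega
        exact pow_le_pow_of_le_one (by norm_num) (by norm_num) hk
    _ = #s * (1 / 2 : ℝ) ^ ((k + 1) / 2) := by rw [sum_const, nsmul_eq_mul]
    _ ≤ (n : ℝ) ^ c * (1 / 2 : ℝ) ^ ((k + 1) / 2) := by
        refine mul_le_mul_of_nonneg_right ?_ (by positivity)
        have : #s ≤ n ^ c := (card_le_univ s).trans (card_coeffVec (n := n) (c := c)).le
        exact_mod_cast this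

/-- **CKR Lemma 2.17** (approximators make many errors): for an approximator `𝒜`,
`Pr[S_𝐘 ∈ 𝒜] + Pr[𝐍 ∉ 𝒜] ≤ 3/2` — if `∅ ∈ 𝒜` the up-set `𝒜` accepts everything, otherwise it
accepts the positive test input with probability `≤ 1/2`. [cite: CavalarKumarRossman2022, Lemma 2.17] -/
theorem sum_val_add_prHalf_not_mem_le (hkn : k < n) (hε0 : 0 < ε) (hε1 : ε ≤ 1 / 2)
    (hH : 2 * spreadConst * Real.log (c / ε) * k / n ≤ 1 / 3) {𝒜 : Finset (Finset (ZMod n))}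
    (h𝒜 : IsApprox c ε 𝒜) :
    ∑ _v ∈ univ.filter (fun v : Fin c → ZMod n => hrSet k v ∈ 𝒜), (1 / n ^ c : ℝ)
      + prHalf (fun U : Finset (ZMod n) => U ∉ 𝒜) ≤ 3 / 2 := by
  have hn : (0 : ℝ) < n := by exact_mod_cast (Fact.out : n.Prime).pos
  by_cases h0 : ∅ ∈ 𝒜
  · have hall : ∀ U : Finset (ZMod n), U ∈ 𝒜 := fun U => h𝒜.isUpperSet (empty_subset U) h0
    rw [prHalf_eq_zero fun U h => h (hall U), add_zero]
    calc ∑ _v ∈ univ.filter (fun v : Fin c → ZMod n => hrSet k v ∈ 𝒜), (1 / n ^ c : ℝ)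
        ≤ ∑ _v : Fin c → ZMod n, (1 / n ^ c : ℝ) :=
          sum_le_sum_of_subset_of_nonneg (filter_subset _ _) fun _ _ _ => by positivity
      _ = 1 := by
          rw [sum_const, card_univ, card_coeffVec, nsmul_eq_mul]
          push_cast
          field_simp
      _ ≤ 3 / 2 := by norm_num
  · have h1 := sum_filter_mem_le_half hkn hε0 hε1 hH h𝒜 h0
    have h2 := prHalf_le_one (fun U : Finset (ZMod n) => U ∉ 𝒜)
    linarith

/-- **CKR Theorem 2.19, parametric form** (monotone circuits for the Harnik–Raz function are
large): for a prime `n`, `2 ≤ c`, `1 ≤ k < n`, `0 < ε ≤ 1/2` with `2 B log(c/ε) k/n ≤ 1/3`, every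
circuit over `{∧₂, ∨₂}` computing `f_HR^{(c,k)}` satisfies
`½ - (k-1)/n - n^c 2^{-⌈k/2⌉} ≤ size · (½ 3^{-⌊c/2⌋} + ε · #{A : |A| ≤ c})`
(CKR: `9/5 ≤ Pr[f(𝐘)=1] + Pr[f(𝐍)=0] ≤ 3/2 + size · 2^{-Ω(c)}`).
[cite: CavalarKumarRossman2022, Thm. 2.19] -/
theorem harnikRaz_size_mul_ge (hc : 2 ≤ c) (hk : 1 ≤ k) (hkn : k < n) (hε0 : 0 < ε) (hε1 : ε ≤ 1 / 2)
    (hH : 2 * spreadConst * Real.log (c / ε) * k / n ≤ 1 / 3)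
    (C : Circuit (ZMod n)) (hC : C.IsOver monotoneBasis) (hf : C.Computes (harnikRazFn n c k)) :
    1 / 2 - (k - 1 : ℝ) / n - (n : ℝ) ^ c * (1 / 2 : ℝ) ^ ((k + 1) / 2)
      ≤ C.size * (1 / 2 * (1 / 3 : ℝ) ^ (c / 2)
          + ε * #(univ.filter fun A : Finset (ZMod n) => #A ≤ c)) := by
  classical
  have hn0 : 0 < n := (Fact.out : n.Prime).pos
  have hn : (0 : ℝ) < n := by exact_mod_cast hn0
  have hc1 : 1 ≤ c := by omega
  set S := scheme (V := ZMod n) c ε hc hε1 with hS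
  set f := harnikRazFn n c k with hfdef
  set ptP : (Fin c → ZMod n) → ZMod n → Bool := fun v => finsetEquivFun (hrSet k v) with hptP
  set wP : (Fin c → ZMod n) → ℝ := fun _ => 1 / n ^ c with hwP
  set wN : Finset (ZMod n) → ℝ := fun _ => 1 / 2 ^ Fintype.card (ZMod n) with hwN
  set δP : ℝ := 1 / 2 * (1 / 3 : ℝ) ^ (c / 2) with hδP
  set δN : ℝ := ε * #(univ.filter fun A : Finset (ZMod n) => #A ≤ c) with hδN
  have hwP0 : ∀ v, 0 ≤ wP v := fun _ => by positivity
  have hwN0 : ∀ U, 0 ≤ wN U := fun _ => by positivity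
  -- the approximation method
  obtain ⟨𝒜, BadP, BadN, hok, hcP, hcN, hpos, hneg⟩ :=
    S.exists_approx_circuit univ ptP wP univ finsetEquivFun wN hwP0 hwN0 δP δN
      (fun a b ha hb => sum_lostSup_le hc hε1 hkn hε0 hH ha hb)
      (fun a b ha hb => sum_lostInf_le hc hε1 hkn hε0 hH ha hb)
      (fun a b ha hb => sum_gainedSup_le hc hε1 hε0.le ha hb)
      (fun a b ha hb => sum_gainedInf_le hc hε1 hε0.le ha hb) C hC hf
  obtain ⟨hW1, hW2⟩ := S.weight_le_of_approx (P := univ) (N := univ) hwP0 hwN0 hcP hcN hpos hneg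
  have hok' : IsApprox c ε 𝒜 := hok
  -- rewrite the approximator events
  have hB1 : ∑ s ∈ univ.filter (fun s => S.val 𝒜 (ptP s) = true), wP s
      = ∑ _v ∈ univ.filter (fun v : Fin c → ZMod n => hrSet k v ∈ 𝒜), (1 / n ^ c : ℝ) := by
    refine sum_congr ?_ fun _ _ => rfl
    ext v
    simp [hptP, hS]
  have hB2 : ∑ s ∈ univ.filter (fun s => S.val 𝒜 (finsetEquivFun s) = false), wN s
      = prHalf (fun U : Finset (ZMod n) => U ∉ 𝒜) := by
    have hset : (univ.filter fun s : Finset (ZMod n) => S.val 𝒜 (finsetEquivFun s) = false)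
        = univ.filter fun U : Finset (ZMod n) => U ∉ 𝒜 := by
      ext U
      simp [hS]
    rw [hset, sum_const, nsmul_eq_mul, prHalf, mul_one_div]
  have hU := sum_val_add_prHalf_not_mem_le hkn hε0 hε1 hH hok' (k := k)
  -- the positive test distribution: `Pr[f(𝐘) = 1] ≥ 1 - (k-1)/n` (Lemma 2.3)
  have hL1 : 1 - (k - 1 : ℝ) / n ≤ ∑ s ∈ univ.filter (fun s => f (ptP s) = true), wP s := by
    set b := #(univ.filter fun v : Fin c → ZMod n => 2 * #(hrSet k v) < k) with hb
    have hbad : #(univ.filter fun s : Fin c → ZMod n => ¬ f (ptP s) = true) ≤ b := by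
      refine card_le_card (monotone_filter_right _ fun v _ hv => ?_)
      by_contra hlt
      exact hv (harnikRazFn_hrSet hc1 (not_lt.1 hlt))
    have hsplit := card_filter_add_card_filter_not (s := (univ : Finset (Fin c → ZMod n)))
      (fun s => f (ptP s) = true)
    rw [card_univ, card_coeffVec] at hsplit
    have hbn : b * n ≤ (k - 1) * n ^ c := card_filter_hrSet_small_mul_le hc hkn
    rw [sum_const, nsmul_eq_mul]
    have hgood : (#(univ.filter fun s : Fin c → ZMod n => f (ptP s) = true) : ℝ)
        = n ^ c - #(univ.filter fun s : Fin c → ZMod n => ¬ f (ptP s) = true) := by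
      rw [eq_sub_iff_add_eq]; exact_mod_cast hsplit
    have hbn' : (b : ℝ) * n ≤ ((k - 1 : ℕ) : ℝ) * n ^ c := by exact_mod_cast hbn
    have hbad' : (#(univ.filter fun s : Fin c → ZMod n => ¬ f (ptP s) = true) : ℝ) ≤ b := by
      exact_mod_cast hbad
    have hnc : (0 : ℝ) < n ^ c := by positivity
    rw [hgood]
    -- `(n^c - bad)/n^c ≥ 1 - b/n^c ≥ 1 - (k-1)/n`
    have h1 : ((n : ℝ) ^ c - #(univ.filter fun s : Fin c → ZMod n => ¬ f (ptP s) = true)) * (1 / n ^ c)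
        ≥ 1 - (b : ℝ) / n ^ c := by
      rw [sub_mul, mul_one_div_cancel hnc.ne', mul_one_div]
      exact sub_le_sub_left (div_le_div_of_nonneg_right hbad' hnc.le) 1
    have h2 : (b : ℝ) / n ^ c ≤ (k - 1 : ℝ) / n := by
      rw [div_le_div_iff₀ hnc hn]
      have : ((k - 1 : ℕ) : ℝ) * n ^ c = (k - 1 : ℝ) * n ^ c := by
        rw [Nat.cast_sub hk, Nat.cast_one]
      linarith
    linarith
  -- the negative test distribution: `Pr[f(𝐍) = 0] ≥ 1 - n^c 2^{-⌈k/2⌉}` (Lemma 2.4)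
  have hL2 : 1 - (n : ℝ) ^ c * (1 / 2 : ℝ) ^ ((k + 1) / 2)
      ≤ ∑ s ∈ univ.filter (fun s => f (finsetEquivFun s) = false), wN s := by
    have hA2 : ∑ s ∈ univ.filter (fun s => f (finsetEquivFun s) = false), wN s
        = prHalf (fun U : Finset (ZMod n) => f (finsetEquivFun U) = false) := by
      rw [sum_const, nsmul_eq_mul, prHalf, mul_one_div]
    have hnot : prHalf (fun U : Finset (ZMod n) => f (finsetEquivFun U) = false)
        = 1 - prHalf (fun U : Finset (ZMod n) => f (finsetEquivFun U) = true) := by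
      have hset : (univ.filter fun U : Finset (ZMod n) => f (finsetEquivFun U) = false)
          = univ.filter fun U : Finset (ZMod n) => ¬ f (finsetEquivFun U) = true := by
        ext U
        simp
      rw [← prHalf_not]
      unfold prHalf
      rw [hset]
    rw [hA2, hnot]
    have := prHalf_harnikRazFn_le (n := n) (c := c) (k := k)
    linarith
  -- assemble
  have hsum : (1 - (k - 1 : ℝ) / n) + (1 - (n : ℝ) ^ c * (1 / 2 : ℝ) ^ ((k + 1) / 2))
      ≤ C.size * δP + C.size * δN + 3 / 2 := by
    rw [hB1] at hW1
    rw [hB2] at hW2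
    linarith
  calc 1 / 2 - (k - 1 : ℝ) / n - (n : ℝ) ^ c * (1 / 2 : ℝ) ^ ((k + 1) / 2)
      = (1 - (k - 1 : ℝ) / n) + (1 - (n : ℝ) ^ c * (1 / 2 : ℝ) ^ ((k + 1) / 2)) - 3 / 2 := by ring
    _ ≤ C.size * δP + C.size * δN := by linarith
    _ = C.size * (δP + δN) := by ring

end Literature.Computability.Complexity.CKR
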